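import Summits.CriticalPhenomena.PercolationContinuityZ3.Theorems.PercNearOneGluingNoHeavyConstsLinearLowerTailGluedGroups
import HarnessLib

/-!
# The terminal-cycle bound with DUST: `(LT³⁄₂)` holds exactly when `o ∈ A` and all but `(1−κ)|A|` relay points sit in two reliable groups

builds on p205010 (kernel theorem, internal audit signed; external expert review pending)

PAPER-2 track "percolation constants", part (ii), seat `prim-consts-1` (lane index `run/shared/lean/prim/consts/CONSTANTS.md`,
row A19).  Support file for the crux `NoHeavyLowerTail` (stmt-CriticalPhenomena-4575; `--supports … --as helper`): theorems only,
no definitions, no sorries, standard axioms.  Companion of `…ConstsLinearLowerTailGluedGroups` (terminal-cycle bound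
`P(1 ≤ N < κ·EN) ≤ (L/2)·s + η`).

* `Consts.real_lowerTail_le_half_cycle_add_of_dust` — the same bound when only a sub-family `A'` of the relay points is attached to
  the terminal cycle, provided the observer `o ∈ A` is the terminal `u_0` and the unattached DUST `A ∖ A'` has at most `(1−κ)·|A|`
  points: a bad configuration misses more than `|A| − κ·EN ≥ (1−κ)|A|` relay points, hence an attached one, whose terminal is then cut
  from the terminal `o`; two consecutive pairs of the cycle are cut (`Consts.two_le_card_sep_of_cycle`).
* `Consts.real_lowerTail_le_three_halves_of_two_glued_dust` — **`(LT³⁄₂)` exactly, with dust**: if `o, x₁, x₂ ∈ A` and all relay points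
  outside a set of at most `(1−κ)|A|` "dust" points are `o` or almost surely joined to `x₁` or to `x₂`, then
  `P(1 ≤ N < κ·EN) ≤ (3/2)·s` (every `κ`, every `s ≥ max P(a ↮ a')`, any wiring, any behaviour of the dust).  At `κ = 2/3` a third of
  the relay set may be arbitrary.  What remains open of `Consts.LinearLowerTailThreeHalves` is therefore the DIFFUSE regime (more than
  a third of the relay mass outside any two reliable groups), where the pair-marginal LP barrier (`…PairLP`) lives.
References: G. Kozma, N. Nitzan, arXiv:2401.12397 (2024), Conjecture 1 (p. 3); G. Grimmett, *Percolation* (1999), §1.3.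
-/

noncomputable section

namespace Summit.CriticalPhenomena.PercolationContinuityZ3.Theorems

open MeasureTheory Set Literature.Probability.LatticeModels Literature.Probability.Percolation
open scoped Classical

namespace Consts

/-- **Terminal-cycle bound with dust.**  As `real_lowerTail_le_half_cycle_add`, but only a sub-family `A'` of relay points needs
to be attached to the terminals, provided the observer is the terminal `u_0 = o ∈ A` and the unattached "dust" `A ∖ A'` has at most
`(1 − κ)·|A|` points: a bad configuration misses more than `(1−κ)|A|` relay points, so it misses an attached one, whose terminal is
then cut from the terminal `o`.  Hence `P(1 ≤ N < κ·EN) ≤ (L/2)·s + Σ_{a∈A'} P(u_{g a} ↮ a)`; for `κ ≤ 2/3` a third of the relay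
set may be dust. [cite: KozmaNitzan2024, Conj. 1 (p. 3)] -/
theorem real_lowerTail_le_half_cycle_add_of_dust (n : ℕ) (w : Sym2 (Fin n) → unitInterval) (A A' : Finset (Fin n)) (o : Fin n)
    (L : ℕ) (u : ℕ → Fin n) (hu0 : u 0 = o) (ho : o ∈ A) (huA : ∀ k, k < L → u k ∈ A) (huL : u L = u 0)
    (g : Fin n → ℕ) (hg : ∀ a ∈ A', g a < L) {κ s : ℝ} (hdust : (((A \ A').card : ℕ) : ℝ) ≤ (1 - κ) * A.card)
    (hrel : ∀ a ∈ A, ∀ a' ∈ A, (prodBernoulli w).real (openConn a a')ᶜ ≤ s) :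
    (prodBernoulli w).real {ω : BondConfig (Fin n) | 1 ≤ (A.filter fun a => ω ∈ openConn o a).card ∧
        ((A.filter fun a => ω ∈ openConn o a).card : ℝ) < κ * (∑ a ∈ A, (prodBernoulli w).real (openConn o a))} ≤
      (L : ℝ) / 2 * s + ∑ a ∈ A', (prodBernoulli w).real (openConn (u (g a)) a)ᶜ := by
  set μ := prodBernoulli w with hμ
  set EN : ℝ := ∑ a ∈ A, μ.real (openConn o a) with hEN
  set bad := {ω : BondConfig (Fin n) | 1 ≤ (A.filter fun a => ω ∈ openConn o a).card ∧
        ((A.filter fun a => ω ∈ openConn o a).card : ℝ) < κ * EN} with hbad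
  set Z := {ω : BondConfig (Fin n) | ∃ a ∈ A', ω ∉ openConn (u (g a)) a} with hZ
  have hZle : μ.real Z ≤ ∑ a ∈ A', μ.real (openConn (u (g a)) a)ᶜ := by
    have hU : Z = ⋃ a ∈ A', (openConn (u (g a)) a)ᶜ := by
      ext ω; simp only [hZ, mem_setOf_eq, mem_iUnion, mem_compl_iff, exists_prop]
    rw [hU]
    exact measureReal_biUnion_finset_le A' _
  have hENle : EN ≤ A.card := by
    calc EN = ∑ a ∈ A, μ.real (openConn o a) := rfl
      _ ≤ ∑ _a ∈ A, (1 : ℝ) := Finset.sum_le_sum fun a _ => measureReal_le_one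
      _ = A.card := by rw [Finset.sum_const, nsmul_eq_mul, mul_one]
  set T : ℕ → Set (BondConfig (Fin n)) := fun k => (openConn (u k) (u (k + 1)))ᶜ with hT
  have hpt : ∀ ω ∈ bad \ Z, (2 : ℝ) ≤ ∑ k ∈ Finset.range L, (T k).indicator (fun _ => (1 : ℝ)) ω := by
    rintro ω ⟨⟨hN1, hNlt⟩, hωZ⟩
    simp only [hZ, mem_setOf_eq, not_exists, not_and, not_not] at hωZ
    -- the missed set `R` has more than `(1-κ)|A| ≥ |A \ A'|` points, so it meets `A'`
    set K := A.filter fun a => ω ∈ openConn o a with hK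
    set R := A.filter fun a => ω ∉ openConn o a with hR
    have hKR : K.card + R.card = A.card := by
      rw [hK, hR]; exact Finset.card_filter_add_card_filter_not _
    have hRgt : (((A \ A').card : ℕ) : ℝ) < R.card := by
      have hENnn : 0 ≤ EN := Finset.sum_nonneg fun a _ => measureReal_nonneg
      have h1 : (K.card : ℝ) < κ * EN := hNlt
      have h2 : (K.card : ℝ) + R.card = A.card := by exact_mod_cast hKR
      have hK1 : (1 : ℝ) ≤ K.card := by exact_mod_cast hN1
      by_cases hκ0 : 0 ≤ κ
      · have h3 : κ * EN ≤ κ * A.card := mul_le_mul_of_nonneg_left hENle hκ0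
        nlinarith
      · have h3 : κ * EN ≤ 0 := mul_nonpos_of_nonpos_of_nonneg (by linarith) hENnn
        linarith
    obtain ⟨a', ha'R, ha'A'⟩ : ∃ a' ∈ R, a' ∈ A' := by
      by_contra hno
      push Not at hno
      have hsub : R ⊆ A \ A' := fun a ha => Finset.mem_sdiff.2 ⟨(Finset.mem_filter.1 ha).1, hno a ha⟩
      have := Finset.card_le_card hsub
      have : (R.card : ℝ) ≤ ((A \ A').card : ℕ) := by exact_mod_cast this
      linarith
    have ha'c : ω ∉ openConn o a' := (Finset.mem_filter.1 ha'R).2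
    have hta' : ω ∉ openConn (u 0) (u (g a')) := by
      rw [hu0]; exact fun h => ha'c (h.trans (hωZ a' ha'A'))
    have h2 := two_le_card_sep_of_cycle ω u L huL (Nat.zero_le L) (hg a' ha'A').le hta'
    refine h2.trans (le_of_eq (Finset.sum_congr rfl fun k _ => ?_))
    by_cases hk : ω ∈ openConn (u k) (u (k + 1))
    · rw [if_pos hk, Set.indicator_of_notMem (show ω ∉ T k from fun h => h hk)]
    · rw [if_neg hk, Set.indicator_of_mem (show ω ∈ T k from hk)]
  have hdc := mul_measureReal_le_sum_inter μ (bad \ Z) (Finset.range L) T 2 hpt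
  have hTle : ∀ k ∈ Finset.range L, μ.real ((bad \ Z) ∩ T k) ≤ s := by
    intro k hk
    have hkL : k < L := Finset.mem_range.1 hk
    refine (measureReal_mono inter_subset_right (measure_ne_top _ _)).trans ?_
    have hk1 : u (k + 1) ∈ A := by
      rcases Nat.lt_or_ge (k + 1) L with h | h
      · exact huA (k + 1) h
      · have : k + 1 = L := le_antisymm hkL h
        rw [this, huL, hu0]; exact ho
    exact hrel (u k) (huA k hkL) (u (k + 1)) hk1
  have hsum : ∑ k ∈ Finset.range L, μ.real ((bad \ Z) ∩ T k) ≤ L * s := by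
    calc ∑ k ∈ Finset.range L, μ.real ((bad \ Z) ∩ T k) ≤ ∑ _k ∈ Finset.range L, s := Finset.sum_le_sum hTle
      _ = L * s := by rw [Finset.sum_const, Finset.card_range, nsmul_eq_mul]
  have hsplit : μ.real bad ≤ μ.real (bad \ Z) + μ.real Z := by
    have hcov : bad ⊆ (bad \ Z) ∪ Z := fun ω hω => by
      by_cases hz : ω ∈ Z
      · exact Or.inr hz
      · exact Or.inl ⟨hω, hz⟩
    exact (measureReal_mono hcov (measure_ne_top _ _)).trans (measureReal_union_le _ _)
  have hbz : μ.real (bad \ Z) ≤ (L : ℝ) / 2 * s := by linarith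
  linarith

/-- **(LT³⁄₂) with dust: `o ∈ A`, two internally reliable groups carrying at least `κ·|A|`… precisely: all but at most `(1−κ)|A|` relay
points almost surely joined to `x₁` or `x₂` (or equal to `o`) ⇒ `P(1 ≤ N < κ·EN) ≤ (3/2)·s`.**  For `κ = 2/3`: a third of the relay
set may be arbitrary. [cite: KozmaNitzan2024, Conj. 1 (p. 3)] -/
theorem real_lowerTail_le_three_halves_of_two_glued_dust (n : ℕ) (w : Sym2 (Fin n) → unitInterval) (A A' : Finset (Fin n))
    (o x₁ x₂ : Fin n) (ho : o ∈ A) (hx₁ : x₁ ∈ A) (hx₂ : x₂ ∈ A)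
    (hglue : ∀ a ∈ A', a = o ∨ (prodBernoulli w).real (openConn x₁ a) = 1 ∨ (prodBernoulli w).real (openConn x₂ a) = 1)
    {κ s : ℝ} (hdust : (((A \ A').card : ℕ) : ℝ) ≤ (1 - κ) * A.card)
    (hrel : ∀ a ∈ A, ∀ a' ∈ A, (prodBernoulli w).real (openConn a a')ᶜ ≤ s) :
    (prodBernoulli w).real {ω : BondConfig (Fin n) | 1 ≤ (A.filter fun a => ω ∈ openConn o a).card ∧
        ((A.filter fun a => ω ∈ openConn o a).card : ℝ) < κ * (∑ a ∈ A, (prodBernoulli w).real (openConn o a))} ≤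
      3 / 2 * s := by
  set μ := prodBernoulli w with hμ
  set u : ℕ → Fin n := fun k => if k = 0 then o else if k = 1 then x₁ else if k = 2 then x₂ else o with hu
  set g : Fin n → ℕ := fun a => if a = o then 0 else if μ.real (openConn x₁ a) = 1 then 1 else 2 with hg
  have hu0 : u 0 = o := by simp [hu]
  have huA : ∀ k, k < 3 → u k ∈ A := by
    intro k hk
    interval_cases k <;> simp [hu, ho, hx₁, hx₂]
  have huL : u 3 = u 0 := by simp [hu]
  have hgL : ∀ a ∈ A', g a < 3 := by
    intro a _; simp only [hg]; split_ifs <;> norm_num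
  have hcompl1 : ∀ x a : Fin n, μ.real (openConn x a) = 1 → μ.real (openConn x a)ᶜ = 0 := by
    intro x a h
    rw [measureReal_compl MeasurableSet.of_discrete, probReal_univ, h, sub_self]
  have hrefl : ∀ a : Fin n, μ.real (openConn a a)ᶜ = 0 := fun a => by
    have : (openConn a a : Set (BondConfig (Fin n))) = univ := Set.eq_univ_of_forall fun ω => SimpleGraph.Reachable.refl _
    rw [this, Set.compl_univ, measureReal_empty]
  have hη : ∑ a ∈ A', μ.real (openConn (u (g a)) a)ᶜ = 0 := by
    refine Finset.sum_eq_zero fun a ha => ?_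
    by_cases hao : a = o
    · have : u (g a) = a := by simp [hg, hu, hao]
      rw [this]; exact hrefl a
    · rcases hglue a ha with h | h1 | h2
      · exact absurd h hao
      · have : u (g a) = x₁ := by simp [hg, hu, hao, h1]
        rw [this]; exact hcompl1 x₁ a h1
      · by_cases h1 : μ.real (openConn x₁ a) = 1
        · have : u (g a) = x₁ := by simp [hg, hu, hao, h1]
          rw [this]; exact hcompl1 x₁ a h1
        · have : u (g a) = x₂ := by simp [hg, hu, hao, h1]
          rw [this]; exact hcompl1 x₂ a h2
  have h := real_lowerTail_le_half_cycle_add_of_dust n w A A' o 3 u hu0 ho huA huL g hgL hdust hrel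
  rw [hη, add_zero] at h
  refine h.trans (le_of_eq ?_)
  norm_num

/-- **(LT³⁄₂) for small relay sets: `o ∈ A`, `κ ≤ 1` and `κ·|A| ≤ 3` ⇒ `P(1 ≤ N < κ·EN) ≤ (3/2)·s`** on every finite weighted graph
(any two further relay points serve as the two groups, the remaining `|A| − 3 ≤ (1−κ)|A|` points as dust).  At `κ = 2/3` this covers
`|A| ≤ 4`, at `κ = 1/2` it covers `|A| ≤ 6`. [cite: KozmaNitzan2024, Conj. 1 (p. 3)] -/
theorem real_lowerTail_le_three_halves_of_card_le (n : ℕ) (w : Sym2 (Fin n) → unitInterval) (A : Finset (Fin n)) (o : Fin n)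
    (ho : o ∈ A) {κ s : ℝ} (hκ : κ ≤ 1) (hκA : κ * A.card ≤ 3)
    (hrel : ∀ a ∈ A, ∀ a' ∈ A, (prodBernoulli w).real (openConn a a')ᶜ ≤ s) :
    (prodBernoulli w).real {ω : BondConfig (Fin n) | 1 ≤ (A.filter fun a => ω ∈ openConn o a).card ∧
        ((A.filter fun a => ω ∈ openConn o a).card : ℝ) < κ * (∑ a ∈ A, (prodBernoulli w).real (openConn o a))} ≤
      3 / 2 * s := by
  set μ := prodBernoulli w with hμ
  -- two further relay points (or `o` again if there are none)
  obtain ⟨x₁, hx₁A, hx₁B⟩ : ∃ x₁ ∈ A, ((A.erase o).Nonempty → x₁ ∈ A.erase o) := by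
    by_cases h : (A.erase o).Nonempty
    · obtain ⟨x, hx⟩ := h; exact ⟨x, Finset.mem_of_mem_erase hx, fun _ => hx⟩
    · exact ⟨o, ho, fun h' => absurd h' h⟩
  obtain ⟨x₂, hx₂A, hx₂B⟩ : ∃ x₂ ∈ A, (((A.erase o).erase x₁).Nonempty → x₂ ∈ (A.erase o).erase x₁) := by
    by_cases h : ((A.erase o).erase x₁).Nonempty
    · obtain ⟨x, hx⟩ := h
      exact ⟨x, Finset.mem_of_mem_erase (Finset.mem_of_mem_erase hx), fun _ => hx⟩
    · exact ⟨o, ho, fun h' => absurd h' h⟩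
  set A' : Finset (Fin n) := insert o (insert x₁ {x₂}) with hA'
  have hrefl : ∀ x : Fin n, μ.real (openConn x x) = 1 := fun x => by
    have : (openConn x x : Set (BondConfig (Fin n))) = univ := Set.eq_univ_of_forall fun ω => SimpleGraph.Reachable.refl _
    rw [this, probReal_univ]
  have hglue : ∀ a ∈ A', a = o ∨ μ.real (openConn x₁ a) = 1 ∨ μ.real (openConn x₂ a) = 1 := by
    intro a ha
    simp only [hA', Finset.mem_insert, Finset.mem_singleton] at ha
    rcases ha with rfl | rfl | rfl
    · exact Or.inl rfl
    · exact Or.inr (Or.inl (hrefl a))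
    · exact Or.inr (Or.inr (hrefl a))
  -- the dust `A \ A'` sits inside `((A.erase o).erase x₁).erase x₂`
  set R := ((A.erase o).erase x₁).erase x₂ with hR
  have hsub : A \ A' ⊆ R := by
    intro a ha
    rw [Finset.mem_sdiff] at ha
    simp only [hA', Finset.mem_insert, Finset.mem_singleton, not_or] at ha
    obtain ⟨haA, hao, hax₁, hax₂⟩ := ha
    exact Finset.mem_erase.2 ⟨hax₂, Finset.mem_erase.2 ⟨hax₁, Finset.mem_erase.2 ⟨hao, haA⟩⟩⟩
  have hRcard : (R.card : ℝ) ≤ (1 - κ) * A.card := by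
    have hM0 : (0 : ℝ) ≤ A.card := Nat.cast_nonneg _
    by_cases h1 : (A.erase o).Nonempty
    · have hx₁' := hx₁B h1
      by_cases h2 : ((A.erase o).erase x₁).Nonempty
      · have hx₂' := hx₂B h2
        have hc : R.card = A.card - 3 := by
          rw [hR, Finset.card_erase_of_mem hx₂', Finset.card_erase_of_mem hx₁', Finset.card_erase_of_mem ho]
          omega
        have h3 : 3 ≤ A.card := by
          have := Finset.card_pos.2 h2
          rw [Finset.card_erase_of_mem hx₁', Finset.card_erase_of_mem ho] at this
          omega
        rw [hc, Nat.cast_sub h3]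
        push_cast
        nlinarith
      · have hempty : (A.erase o).erase x₁ = ∅ := Finset.not_nonempty_iff_eq_empty.1 h2
        have : R = ∅ := by rw [hR, hempty, Finset.erase_empty]
        rw [this, Finset.card_empty]; push_cast; nlinarith
    · have hempty : A.erase o = ∅ := Finset.not_nonempty_iff_eq_empty.1 h1
      have : R = ∅ := by rw [hR, hempty, Finset.erase_empty, Finset.erase_empty]
      rw [this, Finset.card_empty]; push_cast; nlinarith
  have hdust : (((A \ A').card : ℕ) : ℝ) ≤ (1 - κ) * A.card :=
    le_trans (by exact_mod_cast Finset.card_le_card hsub) hRcard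
  exact real_lowerTail_le_three_halves_of_two_glued_dust n w A A' o x₁ x₂ ho hx₁A hx₂A hglue hdust hrel

/-- **Half the tour, with dust.**  Observer `o = u_0 ∈ A` on a closed sequence `u_0, …, u_{L−1}, u_L = u_0`; a sub-family `A'` of relay
points attached to the sequence (`a ↦ u_{g a}`), the unattached dust `A ∖ A'` having at most `(1−κ)·|A|` points.  Then
`P(1 ≤ N < κ·EN) ≤ ½ Σ_{k<L} P(u_k ↮ u_{k+1}) + Σ_{a∈A'} P(u_{g a} ↮ a)`: the sharper form of
`real_lowerTail_le_half_cycle_add_of_dust` keeping the actual consecutive unreliabilities (so `≤ ½·TSP_d(A″)` for any `A″ ∋ o` carrying all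
but `(1−κ)|A|` relay points, with `A″` toured and attached to itself). [cite: KozmaNitzan2024, Conj. 1 (p. 3)] -/
theorem real_lowerTail_le_half_tour_add_of_dust (n : ℕ) (w : Sym2 (Fin n) → unitInterval) (A A' : Finset (Fin n)) (o : Fin n)
    (L : ℕ) (u : ℕ → Fin n) (hu0 : u 0 = o) (huL : u L = u 0)
    (g : Fin n → ℕ) (hg : ∀ a ∈ A', g a < L) {κ : ℝ} (hdust : (((A \ A').card : ℕ) : ℝ) ≤ (1 - κ) * A.card) :
    (prodBernoulli w).real {ω : BondConfig (Fin n) | 1 ≤ (A.filter fun a => ω ∈ openConn o a).card ∧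
        ((A.filter fun a => ω ∈ openConn o a).card : ℝ) < κ * (∑ a ∈ A, (prodBernoulli w).real (openConn o a))} ≤
      (1 / 2) * (∑ k ∈ Finset.range L, (prodBernoulli w).real (openConn (u k) (u (k + 1)))ᶜ) +
        ∑ a ∈ A', (prodBernoulli w).real (openConn (u (g a)) a)ᶜ := by
  set μ := prodBernoulli w with hμ
  set EN : ℝ := ∑ a ∈ A, μ.real (openConn o a) with hEN
  set bad := {ω : BondConfig (Fin n) | 1 ≤ (A.filter fun a => ω ∈ openConn o a).card ∧
        ((A.filter fun a => ω ∈ openConn o a).card : ℝ) < κ * EN} with hbad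
  set Z := {ω : BondConfig (Fin n) | ∃ a ∈ A', ω ∉ openConn (u (g a)) a} with hZ
  have hZle : μ.real Z ≤ ∑ a ∈ A', μ.real (openConn (u (g a)) a)ᶜ := by
    have hU : Z = ⋃ a ∈ A', (openConn (u (g a)) a)ᶜ := by
      ext ω; simp only [hZ, mem_setOf_eq, mem_iUnion, mem_compl_iff, exists_prop]
    rw [hU]
    exact measureReal_biUnion_finset_le A' _
  have hENle : EN ≤ A.card := by
    calc EN = ∑ a ∈ A, μ.real (openConn o a) := rfl
      _ ≤ ∑ _a ∈ A, (1 : ℝ) := Finset.sum_le_sum fun a _ => measureReal_le_one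
      _ = A.card := by rw [Finset.sum_const, nsmul_eq_mul, mul_one]
  set T : ℕ → Set (BondConfig (Fin n)) := fun k => (openConn (u k) (u (k + 1)))ᶜ with hT
  have hpt : ∀ ω ∈ bad \ Z, (2 : ℝ) ≤ ∑ k ∈ Finset.range L, (T k).indicator (fun _ => (1 : ℝ)) ω := by
    rintro ω ⟨⟨hN1, hNlt⟩, hωZ⟩
    simp only [hZ, mem_setOf_eq, not_exists, not_and, not_not] at hωZ
    set K := A.filter fun a => ω ∈ openConn o a with hK
    set R := A.filter fun a => ω ∉ openConn o a with hR
    have hKR : K.card + R.card = A.card := by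
      rw [hK, hR]; exact Finset.card_filter_add_card_filter_not _
    have hRgt : (((A \ A').card : ℕ) : ℝ) < R.card := by
      have hENnn : 0 ≤ EN := Finset.sum_nonneg fun a _ => measureReal_nonneg
      have h1 : (K.card : ℝ) < κ * EN := hNlt
      have h2 : (K.card : ℝ) + R.card = A.card := by exact_mod_cast hKR
      have hK1 : (1 : ℝ) ≤ K.card := by exact_mod_cast hN1
      by_cases hκ0 : 0 ≤ κ
      · have h3 : κ * EN ≤ κ * A.card := mul_le_mul_of_nonneg_left hENle hκ0
        nlinarith
      · have h3 : κ * EN ≤ 0 := mul_nonpos_of_nonpos_of_nonneg (by linarith) hENnn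
        linarith
    obtain ⟨a', ha'R, ha'A'⟩ : ∃ a' ∈ R, a' ∈ A' := by
      by_contra hno
      push Not at hno
      have hsub : R ⊆ A \ A' := fun a ha => Finset.mem_sdiff.2 ⟨(Finset.mem_filter.1 ha).1, hno a ha⟩
      have := Finset.card_le_card hsub
      have : (R.card : ℝ) ≤ ((A \ A').card : ℕ) := by exact_mod_cast this
      linarith
    have ha'c : ω ∉ openConn o a' := (Finset.mem_filter.1 ha'R).2
    have hta' : ω ∉ openConn (u 0) (u (g a')) := by
      rw [hu0]; exact fun h => ha'c (h.trans (hωZ a' ha'A'))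
    have h2 := two_le_card_sep_of_cycle ω u L huL (Nat.zero_le L) (hg a' ha'A').le hta'
    refine h2.trans (le_of_eq (Finset.sum_congr rfl fun k _ => ?_))
    by_cases hk : ω ∈ openConn (u k) (u (k + 1))
    · rw [if_pos hk, Set.indicator_of_notMem (show ω ∉ T k from fun h => h hk)]
    · rw [if_neg hk, Set.indicator_of_mem (show ω ∈ T k from hk)]
  have hdc := mul_measureReal_le_sum_inter μ (bad \ Z) (Finset.range L) T 2 hpt
  have hsum : ∑ k ∈ Finset.range L, μ.real ((bad \ Z) ∩ T k) ≤ ∑ k ∈ Finset.range L, μ.real (T k) :=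
    Finset.sum_le_sum fun k _ => measureReal_mono inter_subset_right (measure_ne_top _ _)
  have hsplit : μ.real bad ≤ μ.real (bad \ Z) + μ.real Z := by
    have hcov : bad ⊆ (bad \ Z) ∪ Z := fun ω hω => by
      by_cases hz : ω ∈ Z
      · exact Or.inr hz
      · exact Or.inl ⟨hω, hz⟩
    exact (measureReal_mono hcov (measure_ne_top _ _)).trans (measureReal_union_le _ _)
  have hbz : μ.real (bad \ Z) ≤ (1 / 2) * ∑ k ∈ Finset.range L, μ.real (T k) := by linarith
  linarith

end Consts

end Summit.CriticalPhenomena.PercolationContinuityZ3.Theorems
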